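import Summits.Ventures.PercRepro.LineCMinFaceGlue
import Summits.Ventures.PercRepro.LemmaBPointed

/-!
# PercRepro — Φₓ-MIN-FACE: the pointed class sum, its MIN-FACE, and the x-pointed Lemma B⁺ (typer-2, gen 5)

The lead (09:12:12Z, 09:18:46Z, 09:24:56Z; CONJECTURES v48 row LEMMA B⁺ₓ; ASSIGNMENTS v33 typer-2 (a)):
for a crossing cell `x = cross4 a` the **pointed class sum** `Φₓ(c) = CS_B(c) − 2·n_x(c)` subtracts the
**n-pairs pointed at `x`** — antipodal pairs `{ω, ωᶜ}` with `⊥ < c ω < x` (for four marks: `c ω` one of the two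
atoms below `x`) and `c ωᶜ` another crossing cell (p4's `nPairCount cross4 c a`, `LemmaBPointed.lean`). In kernel
form `Φₓ(c) = Σ_ρ Kₓ(c ρ, c ρᶜ)` with `Kₓ = K_N − [σ n-pair at x]` (one extra `−1` entry, symmetrised).

* `nPairInd`, **`pointedKernel a`** (`Kₓ`, symmetric: `pointedKernel_comm`; zero diagonal: `pointedKernel_self`);
* **`pointedSum a c`** (`Φₓ(c)`), **`pointedSum_eq`**: `Φₓ = 2·(topBotCount − crossCount − nPairCount)`,
  **`cubeSumB_eq_pointedSum_add`**: `CS_B = Φₓ + 2·n_x`; `pointedSum_nonneg_iff`: `Φₓ ≥ 0 ⟺ g ≥ b + n_x`;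
* **`XPointedBPlus`** — the x-pointed Lemma B⁺ for single-merge maps, `g ≥ b + n_x` at EVERY `x` (lead: `CS ≥
  max_x n_x`; 0 violations on all 97,127,035 single-merge maps at `d = 5`, all monotone maps at `d ≤ 4`), and
  **`lemmaB_of_xPointed`**: `g ≥ b + n_x ≥ b` gives Lemma B, hence **`C005_of_xPointedBPlus`**;
  `pointedSum_nonneg_of_common`: p4's two-type pointed Lemma B gives `Φₓ ≥ 0` unconditionally when every
  crossing pair contains `x`;
* **`PointedMinFace`** — Φₓ-MIN-FACE in the stamp-65 bilinear shape, for every `x` (the same `x` on all three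
  terms): two single-merge maps `c₀ ≤ c₁` on one cube, `min(Φₓ(c₀), Φₓ(c₁)) ≤ 2·X_{Kₓ}(c₀, c₁)`; the
  all-monotone variant **`MonotonePointedMinFace`** (FALSE at `d = 5`, lead 09:33:04Z — a shape only;
  `pointedMinFace_of_monotone`: single-merge maps are monotone, `SingleMergeMap.monotone`); the facet form
  `PointedMinFaceFacet` (`pointedMinFaceFacet_of_pointedMinFace`);
* **`xPointed_of_pointedMinFace`** — Φₓ-MIN-FACE gives `Φₓ ≥ 0` for every single-merge map by induction on the
  dimension alone (base `d = 0`: `Φₓ = 0`; step: `Φₓ(c) = 2·X_{Kₓ}(c|x_k=0, c|x_k=1)`, `pointedSum_eq_two_mul_crossSum`),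
  i.e. **`xPointedBPlus_of_pointedMinFace`**, hence **`lemmaB_singleMerge_of_pointedMinFace`** and
  **`C005_of_pointedMinFace`** / `C005_of_monotonePointedMinFace`.

STATUS OF RECORD (p4 09:41:57Z / 09:43:23Z, kissat j158343/j158350/j158355, witnesses recounted): **`PointedMinFace`
is FALSE** — true at single-merge `d = 5, 6` (UNSAT), FALSE at `d = 7`: a single-merge map with `g = 7`, `b = 2`,
`n₁ = 5` (B⁺ₓ TIGHT: `g = b + n₁`), so `Φ₁(c) = 0`, while along `k = 6` both facets have `Φ₁ = 1`; the MAX form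
(`MaxPointedMinFace.lean`) fails there too. The all-monotone variant fails already at `d = 5` (lead 09:33:04Z).
What SURVIVES is `XPointedBPlus` itself (UNSAT at single-merge `d ≤ 7`, j158009; `d = 8` running): the pointed
Lemma B⁺ is not inductively closed by a MIN-FACE of `Φₓ`, but `lemmaB_of_xPointed` / `C005_of_xPointedBPlus` stand.
The Props `PointedMinFace` / `MonotonePointedMinFace` / `PointedMinFaceFacet` are kept as the exact record of the
dead inductive statements (lead j157919 / j157961 exhaustive `d = 5`: 1,456,905,525 per-x tests, 0 violations).
-/

namespace PercRepro

open Finset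

/-! ### Single-merge maps are monotone -/

section Mono

variable {S ι : Type*} [Fintype S] [DecidableEq S] [Preorder ι]

/-- A map that does not decrease along any cube edge is monotone (walk up one coordinate at a time;
induction on the number of coordinates still to open). -/
theorem monotone_of_step {c : Config S → ι}
    (hstep : ∀ (ω : Config S) (e : S), ω e = false → c ω ≤ c (Function.update ω e true)) :
    Monotone c := by
  intro ω ω' hle
  suffices key : ∀ (n : ℕ) (ω : Config S), ω ≤ ω' →
      (univ.filter fun e => ω e = false ∧ ω' e = true).card = n → c ω ≤ c ω' from key _ ω hle rfl
  intro n
  induction n with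
  | zero =>
    intro ω hle hcard
    have hD := Finset.card_eq_zero.mp hcard
    have hω : ω = ω' := by
      funext e
      have hnot : ¬ (ω e = false ∧ ω' e = true) := by
        intro h
        have : e ∈ univ.filter fun e => ω e = false ∧ ω' e = true := by
          simp only [Finset.mem_filter, Finset.mem_univ, true_and]
          exact h
        rw [hD] at this
        exact absurd this (Finset.notMem_empty e)
      have hle' : ω e ≤ ω' e := hle e
      cases h1 : ω e <;> cases h2 : ω' e
      · rfl
      · exact absurd ⟨h1, h2⟩ hnot
      · rw [h1, h2] at hle'
        exact absurd hle' (by decide)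
      · rfl
    rw [hω]
  | succ n ih =>
    intro ω hle hcard
    obtain ⟨e, he⟩ : ∃ e, ω e = false ∧ ω' e = true := by
      by_contra hcon
      have : (univ.filter fun e => ω e = false ∧ ω' e = true) = ∅ :=
        Finset.filter_eq_empty_iff.mpr fun e _ h => hcon ⟨e, h⟩
      rw [this, Finset.card_empty] at hcard
      omega
    have hle₁ : Function.update ω e true ≤ ω' := by
      intro e'
      by_cases h : e' = e
      · subst h
        rw [Function.update_self, he.2]
      · rw [Function.update_of_ne h]
        exact hle e'
    have hcard₁ : (univ.filter fun e' => Function.update ω e true e' = false ∧ ω' e' = true).card = n := by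
      have hset : (univ.filter fun e' => Function.update ω e true e' = false ∧ ω' e' = true) =
          (univ.filter fun e' => ω e' = false ∧ ω' e' = true).erase e := by
        ext e'
        simp only [Finset.mem_filter, Finset.mem_univ, true_and, Finset.mem_erase]
        by_cases h : e' = e
        · subst h
          simp
        · rw [Function.update_of_ne h]
          exact ⟨fun hh => ⟨h, hh⟩, fun hh => hh.2⟩
      rw [hset, Finset.card_erase_of_mem (by simp only [Finset.mem_filter, Finset.mem_univ, true_and]; exact he),
        hcard, Nat.add_sub_cancel]
    exact le_trans (hstep ω e he.1) (ih _ hle₁ hcard₁)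

end Mono

/-- **Single-merge maps are monotone** (a single merge only coarsens). -/
theorem SingleMergeMap.monotone {S : Type*} [Fintype S] [DecidableEq S] {c : Config S → Setoid (Fin 4)}
    (hc : SingleMergeMap c) : Monotone c := by
  refine monotone_of_step fun ω e he => ?_
  rcases hc ω e he with h | ⟨i, j, -, hij⟩
  · exact h.le
  · rw [hij]
    exact le_mergeBlocks _ i j

/-! ### The pointed kernel `Kₓ` -/

section PointedKernel

open Classical in
/-- The n-pair indicator at the cell `x a` of a family: `σ` strictly between `⊥` and `x a`, `τ` another
cell `x b` (the lower / upper members of an n-pair pointed at `x a`, p4's `nPairCount`). -/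
noncomputable def nPairInd {k r : ℕ} (x : Fin r → Setoid (Fin k)) (a : Fin r) (σ τ : Setoid (Fin k)) : ℝ :=
  if σ ≠ ⊥ ∧ σ < x a ∧ ∃ b, b ≠ a ∧ τ = x b then 1 else 0

/-- **The pointed kernel `Kₓ`** at the crossing cell `x = cross4 a`: the Lemma-B kernel `K_N` minus the n-pair
indicator in both orders (one extra `−1` entry of the unordered kernel, symmetrised for the ordered sum). -/
noncomputable def pointedKernel (a : Fin 3) (σ τ : Setoid (Fin 4)) : ℝ :=
  nestedKernel σ τ - nPairInd cross4 a σ τ - nPairInd cross4 a τ σ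

/-- `Kₓ` is symmetric. -/
theorem pointedKernel_comm (a : Fin 3) (σ τ : Setoid (Fin 4)) :
    pointedKernel a σ τ = pointedKernel a τ σ := by
  unfold pointedKernel
  rw [nestedKernel_comm]
  ring

/-- A crossing cell is not strictly below another one. -/
theorem not_cross4_lt_cross4 (a b : Fin 3) : ¬ cross4 b < cross4 a := by
  intro h
  by_cases hab : b = a
  · subst hab
    exact lt_irrefl _ h
  · have h1 : cross4 b ⊓ cross4 a = cross4 b := inf_eq_left.mpr h.le
    rw [cross4_inf_eq_bot hab] at h1
    exact cross4_ne_bot b h1.symm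

open Classical in
/-- The n-pair indicator vanishes on the diagonal (a cell is not strictly below another cell). -/
theorem nPairInd_self (a : Fin 3) (σ : Setoid (Fin 4)) : nPairInd cross4 a σ σ = 0 := by
  unfold nPairInd
  rw [if_neg]
  rintro ⟨-, hlt, b, -, hb⟩
  rw [hb] at hlt
  exact not_cross4_lt_cross4 a b hlt

/-- `Kₓ` vanishes on the diagonal. -/
theorem pointedKernel_self (a : Fin 3) (σ : Setoid (Fin 4)) : pointedKernel a σ σ = 0 := by
  unfold pointedKernel
  rw [nestedKernel_self, nPairInd_self, sub_zero, sub_zero]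

end PointedKernel

/-! ### The pointed class sum `Φₓ` -/

section PointedSum

variable {S : Type*} [Fintype S] [DecidableEq S]

/-- **The pointed class sum `Φₓ(c)`** of a cube map at the crossing cell `cross4 a`: the ordered antipodal
sum of `Kₓ`. -/
noncomputable abbrev pointedSum (a : Fin 3) (c : Config S → Setoid (Fin 4)) : ℝ :=
  cubeSum (pointedKernel a) c

open Classical in
/-- The antipodal sum of the n-pair indicator counts the n-pairs pointed at `cross4 a`. -/
theorem sum_nPairInd_compl (a : Fin 3) (c : Config S → Setoid (Fin 4)) :
    ∑ ρ : Config S, nPairInd cross4 a (c ρ) (c ρᶜ) = nPairCount cross4 c a := by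
  unfold nPairInd nPairCount
  rw [Finset.card_filter]
  push_cast
  rfl

open Classical in
/-- … read from the other end of the pairs. -/
theorem sum_nPairInd_compl' (a : Fin 3) (c : Config S → Setoid (Fin 4)) :
    ∑ ρ : Config S, nPairInd cross4 a (c ρᶜ) (c ρ) = nPairCount cross4 c a := by
  rw [← sum_nPairInd_compl a c]
  refine Fintype.sum_equiv (complPerm (S := S)) _ _ fun ρ => ?_
  simp only [complPerm, Function.Involutive.coe_toPerm, compl_compl]

/-- **`Φₓ = 2·(g − b − n_x)`**: the pointed class sum counts good pairs minus crossing pairs minus the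
n-pairs pointed at `x`. -/
theorem pointedSum_eq (a : Fin 3) (c : Config S → Setoid (Fin 4)) :
    pointedSum a c = 2 * (topBotCount c - crossCount cross4 c - nPairCount cross4 c a : ℝ) := by
  unfold pointedSum cubeSum pointedKernel
  simp only [Finset.sum_sub_distrib]
  rw [sum_crossKernel_compl cross4_injective, sum_nPairInd_compl, sum_nPairInd_compl']
  ring

/-- **`CS_B = Φₓ + 2·n_x`**. -/
theorem cubeSumB_eq_pointedSum_add (a : Fin 3) (c : Config S → Setoid (Fin 4)) :
    cubeSumB c = pointedSum a c + 2 * nPairCount cross4 c a := by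
  rw [pointedSum_eq]
  unfold cubeSumB cubeSum
  rw [sum_crossKernel_compl cross4_injective]
  ring

/-- `Φₓ(c) ≥ 0` iff the x-pointed Lemma B⁺ holds at `x`: `g ≥ b + n_x`. -/
theorem pointedSum_nonneg_iff (a : Fin 3) (c : Config S → Setoid (Fin 4)) :
    0 ≤ pointedSum a c ↔ crossCount cross4 c + nPairCount cross4 c a ≤ topBotCount c := by
  rw [pointedSum_eq]
  constructor
  · intro h
    have : (crossCount cross4 c : ℝ) + nPairCount cross4 c a ≤ topBotCount c := by linarith
    exact_mod_cast this
  · intro h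
    have : (crossCount cross4 c : ℝ) + nPairCount cross4 c a ≤ topBotCount c := by exact_mod_cast h
    linarith

/-- **`g ≥ b + n_x ≥ b`**: the x-pointed Lemma B⁺ at any one cell gives Lemma B for the map. -/
theorem cubeSumB_nonneg_of_xPointed (a : Fin 3) {c : Config S → Setoid (Fin 4)}
    (h : crossCount cross4 c + nPairCount cross4 c a ≤ topBotCount c) : 0 ≤ cubeSumB c := by
  rw [cubeSumB_eq_pointedSum_add a c]
  have h1 := (pointedSum_nonneg_iff a c).2 h
  have h2 : (0 : ℝ) ≤ nPairCount cross4 c a := Nat.cast_nonneg _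
  linarith

/-- p4's two-type pointed Lemma B (`crossCount_add_nPairCount_le_topBotCount_cross4`): when every crossing
pair of a monotone map contains the cell `cross4 a`, `Φₓ(c) ≥ 0` unconditionally. -/
theorem pointedSum_nonneg_of_common {c : Config S → Setoid (Fin 4)} (hc : Monotone c) (a : Fin 3)
    (hcommon : ∀ ω : Config S, ∀ i j : Fin 3, i < j → c ω = cross4 i → c ωᶜ = cross4 j →
      i = a ∨ j = a) : 0 ≤ pointedSum a c :=
  (pointedSum_nonneg_iff a c).2 (crossCount_add_nPairCount_le_topBotCount_cross4 c hc a hcommon)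

/-- **`Φₓ(c) = 2 · X_{Kₓ}(c|x_k=0, c|x_k=1)`** at every coordinate. -/
theorem pointedSum_eq_two_mul_crossSum (a : Fin 3) (c : Config S → Setoid (Fin 4)) (k : S) :
    pointedSum a c = 2 * crossSum (pointedKernel a) (facetBot c k) (facetTop c k) := by
  unfold pointedSum
  rw [cubeSum_eq_crossSum_facets (pointedKernel a) c k,
    crossSum_comm (pointedKernel_comm a) (facetTop c k)]
  ring

end PointedSum

/-! ### The x-pointed Lemma B⁺ and Φₓ-MIN-FACE -/

/-- **The x-pointed Lemma B⁺ (B⁺ₓ)** for single-merge maps: `g ≥ b + n_x` at EVERY crossing cell `x`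
(the lead's `CS ≥ max_x n_x`). 0 violations on all 97,127,035 single-merge maps at `d = 5` and on all
monotone maps at `d ≤ 4` (lead 09:12:12Z). -/
def XPointedBPlus : Prop :=
  ∀ {S : Type} [Fintype S] [DecidableEq S] (c : Config S → Setoid (Fin 4)), SingleMergeMap c →
    ∀ a : Fin 3, crossCount cross4 c + nPairCount cross4 c a ≤ topBotCount c

/-- **B⁺ₓ gives Lemma B for single-merge maps** (`g ≥ b + n_x ≥ b`). -/
theorem lemmaB_of_xPointed (h : XPointedBPlus) :
    ∀ {S : Type} [Fintype S] [DecidableEq S] (c : Config S → Setoid (Fin 4)), SingleMergeMap c →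
      0 ≤ cubeSumB c :=
  fun c hc => cubeSumB_nonneg_of_xPointed 0 (h c hc 0)

/-- **B⁺ₓ closes C-005.** -/
theorem C005_of_xPointedBPlus (h : XPointedBPlus) : C005 :=
  C005_of_singleMergeLemmaB (lemmaB_of_xPointed h)

/-- **Φₓ-MIN-FACE** (lead 09:24:56Z; bilinear stamp-65 shape, the same `x` on all three terms): for every
crossing cell `cross4 a` and two single-merge maps `c₀ ≤ c₁` (pointwise) on one cube,
`min(Φₓ(c₀), Φₓ(c₁)) ≤ 2·X_{Kₓ}(c₀, c₁)`. **FALSE** (p4 09:41:57Z, j158355): a single-merge map at `d = 7` with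
`g = 7, b = 2, n₁ = 5` has `Φ₁ = 0` below both facets (`Φ₁ = 1`); true at `d = 5, 6`. Kept as the record. -/
def PointedMinFace : Prop :=
  ∀ (a : Fin 3) {S : Type} [Fintype S] [DecidableEq S] (c₀ c₁ : Config S → Setoid (Fin 4)),
    SingleMergeMap c₀ → SingleMergeMap c₁ → (∀ ρ, c₀ ρ ≤ c₁ ρ) →
      min (pointedSum a c₀) (pointedSum a c₁) ≤ 2 * crossSum (pointedKernel a) c₀ c₁

/-- **Φₓ-MIN-FACE for ALL monotone maps** — the all-monotone variant, 0 violations at `d ≤ 4` but **FALSE at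
`d = 5`** (lead 09:33:04Z, hand-verified annealer witness: `CS = 12`, `n_{x₁} = 5`, `Φ_{x₁} = 2`, both facets at
`k = 4` have `Φ_{x₁} = 4`; not single-merge). Kept as a shape only; the live statement is `PointedMinFace`. -/
def MonotonePointedMinFace : Prop :=
  ∀ (a : Fin 3) {S : Type} [Fintype S] [DecidableEq S] (c₀ c₁ : Config S → Setoid (Fin 4)),
    Monotone c₀ → Monotone c₁ → (∀ ρ, c₀ ρ ≤ c₁ ρ) →
      min (pointedSum a c₀) (pointedSum a c₁) ≤ 2 * crossSum (pointedKernel a) c₀ c₁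

/-- The all-monotone form implies the single-merge form. -/
theorem pointedMinFace_of_monotone (h : MonotonePointedMinFace) : PointedMinFace := by
  intro a S _ _ c₀ c₁ h₀ h₁ hle
  exact h a c₀ c₁ h₀.monotone h₁.monotone hle

/-- **Φₓ-MIN-FACE, facet form**: `Φₓ(c) ≥ min(Φₓ(c|x_k=0), Φₓ(c|x_k=1))` for every single-merge map and
coordinate. FALSE at `d = 7` (p4 j158355, see `PointedMinFace`). -/
def PointedMinFaceFacet : Prop :=
  ∀ (a : Fin 3) {S : Type} [Fintype S] [DecidableEq S] (c : Config S → Setoid (Fin 4)), SingleMergeMap c →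
    ∀ k : S, min (pointedSum a (facetBot c k)) (pointedSum a (facetTop c k)) ≤ pointedSum a c

/-- The bilinear form implies the facet form. -/
theorem pointedMinFaceFacet_of_pointedMinFace (h : PointedMinFace) : PointedMinFaceFacet := by
  intro a S _ _ c hc k
  rw [pointedSum_eq_two_mul_crossSum a c k]
  exact h a (facetBot c k) (facetTop c k) (facetBot_singleMergeMap hc k) (facetTop_singleMergeMap hc k)
    (facetBot_le_facetTop hc k)

/-- **Φₓ-MIN-FACE gives `Φₓ ≥ 0` for every single-merge map** — induction on the dimension alone (the
0-cube has `Φₓ = 0`; both facets are single-merge maps of one dimension less). -/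
theorem xPointed_of_pointedMinFaceFacet (h : PointedMinFaceFacet) (a : Fin 3) :
    ∀ {S : Type} [Fintype S] [DecidableEq S] (c : Config S → Setoid (Fin 4)), SingleMergeMap c →
      0 ≤ pointedSum a c := by
  intro S _ _ c hc
  suffices key : ∀ n : ℕ, ∀ (S : Type) [Fintype S] [DecidableEq S], Fintype.card S = n →
      ∀ c : Config S → Setoid (Fin 4), SingleMergeMap c → 0 ≤ pointedSum a c from key _ S rfl c hc
  intro n
  induction n with
  | zero =>
    intro S _ _ hS c _
    have hempty : IsEmpty S := Fintype.card_eq_zero_iff.mp hS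
    unfold pointedSum cubeSum
    refine Finset.sum_nonneg fun ρ _ => ?_
    have hρ : ρᶜ = ρ := funext fun s => hempty.elim s
    rw [hρ, pointedKernel_self]
  | succ n ih =>
    intro S _ _ hS c hc
    obtain ⟨k⟩ : Nonempty S := Fintype.card_pos_iff.mp (by omega)
    have hcard : Fintype.card {s // s ≠ k} = n := by
      have := Fintype.card_subtype_compl (fun s : S => s = k)
      rw [Fintype.card_subtype_eq, hS] at this
      simpa using this
    refine le_trans (le_min ?_ ?_) (h a c hc k)
    · exact ih _ hcard (facetBot c k) (facetBot_singleMergeMap hc k)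
    · exact ih _ hcard (facetTop c k) (facetTop_singleMergeMap hc k)

/-- **Φₓ-MIN-FACE (bilinear) gives `Φₓ ≥ 0` for every single-merge map.** -/
theorem xPointed_of_pointedMinFace (h : PointedMinFace) (a : Fin 3) :
    ∀ {S : Type} [Fintype S] [DecidableEq S] (c : Config S → Setoid (Fin 4)), SingleMergeMap c →
      0 ≤ pointedSum a c :=
  xPointed_of_pointedMinFaceFacet (pointedMinFaceFacet_of_pointedMinFace h) a

/-- **Φₓ-MIN-FACE gives the x-pointed Lemma B⁺.** -/
theorem xPointedBPlus_of_pointedMinFace (h : PointedMinFace) : XPointedBPlus :=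
  fun c hc a => (pointedSum_nonneg_iff a c).1 (xPointed_of_pointedMinFace h a c hc)

/-- **Φₓ-MIN-FACE gives Lemma B for single-merge maps.** -/
theorem lemmaB_singleMerge_of_pointedMinFace (h : PointedMinFace) :
    ∀ {S : Type} [Fintype S] [DecidableEq S] (c : Config S → Setoid (Fin 4)), SingleMergeMap c →
      0 ≤ cubeSumB c :=
  lemmaB_of_xPointed (xPointedBPlus_of_pointedMinFace h)

/-- **Φₓ-MIN-FACE closes C-005**: one finite lemma in the bilinear shape with the kernel `Kₓ`. -/
theorem C005_of_pointedMinFace (h : PointedMinFace) : C005 :=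
  C005_of_xPointedBPlus (xPointedBPlus_of_pointedMinFace h)

/-- The all-monotone Φₓ-MIN-FACE closes C-005. -/
theorem C005_of_monotonePointedMinFace (h : MonotonePointedMinFace) : C005 :=
  C005_of_pointedMinFace (pointedMinFace_of_monotone h)

end PercRepro
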